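import Summits.Parity.GeneralizedHardyLittlewood.Theorems.LeeYangFibresCellParityLawWalshStep
import Summits.Parity.GeneralizedHardyLittlewood.Theorems.LeeYangFibresAbsoluteUpgradeDipDefs
import Summits.Parity.GeneralizedHardyLittlewood.Theorems.LeeYangFibresAbsoluteUpgradeQuantClipNumerics
import HarnessLib

/-!
# Route `LeeYangFibres`, crux `CellParityLawSaving` (stmt-Parity-18104),
# line `superpoly-band-same-atom`: the registered stub `stub_walshStepSav` —
# the Walsh / tensor induction step along the schedule

We prove `WalshStepSav` (vocabulary file `LeeYangFibresCellParityLawSavingDefs`, here with all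
bodies inlined): given the anatomy bounds ALONG THE SCHEDULE `u = U(N) = slowDegree N` in log-power
currency (`a_m ≤ (log N)^ε/log N`, `a_m ≥ (log N)^{-ε}/log N` on the bulk `1 ≤ m < U`, `a_U = 0`,
for every `ε > 0` and `N ≥ N₀(ε)`) and the sister crux's singular-series bookkeeping
`SingularRatioBound` (`𝔖, 𝔖₋ᵢ ≥ 0`, `𝔖 ≤ C_s (log log N)^D 𝔖₋ᵢ`), the one-parameter section law
along the schedule for `(t+1)`-form systems (saving `(log N)^{-δ₁}`) and the law along the schedule
for `t`-form systems (saving `(log N)^{-δ₂}`) give the law along the schedule for `(t+1)`-form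
systems, with saving `(log N)^{-δ₀/2}`, `δ₀ = min(δ₁, δ₂)`.

This is a port of the sister's landed `stub_walshStep` (`LeeYangFibresCellParityLawWalshStep`,
budgets `(log log N)^{-B}`) to `(log N)^{-δ}` budgets; the combinatorics is the landed abstract
assembly `ParityWalsh.exists_walshSum_of_sections` / `ParityWalsh.abs_sub_main_le_of_section`, and
the sister's helpers `WalshStepAux.sectionMass_one_eq_cell` (half-body identity),
`modelDensity_nonneg`, `abs_parityWeight_le` are reused verbatim. Fix `L`; take `δ₁, δ₂` and the
thresholds of the two hypotheses at `L`, `C_s, D` from `SingularRatioBound`, and the densities at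
`ε := δ₀/(8(t+2))`.

1. *Coordinate estimate.* Exactly as in the sister: the fibre mass `sectionMass Ψ K N U i j' 1` is
   the cell count of `Ψ₋ᵢ = Fin.removeNth i Ψ` over the convex half-body `K ∩ {ψ_i > 0}`
   (archimedean factor `β_∞(Ψ, K)`, size `≤ L`), priced by the induction hypothesis; fed into the
   section law through `abs_sub_main_le_of_section` with `a₊ = (log N)^ε/log N`,
   `R₊ = C_s (log log N)^D` it gives the section estimates with error
   `E = N/(ℓ^{t+1} ℓ^{δ₁}) + 2 (ℓ^ε/ℓ) C_s (log ℓ)^D · N/(ℓ^t ℓ^{δ₂})`, `ℓ = log N`.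
2. *Assembly.* `exists_walshSum_of_sections` with `u = U(N) ≥ 4 ≥ 2`, `a₋ = ℓ^{-ε}/ℓ`,
   `a₊ = ℓ^ε/ℓ` gives the parity-vector law with error `2^{t+3} (a₊/a₋)^{t+1} E`,
   `a₊/a₋ = ℓ^{2ε}`.
3. *Budget* (`WalshStepSavAux.budget_le`, the only new arithmetic): once `(log ℓ)^D ≤ ℓ^ε` and
   `2^{t+3}(1 + 2 C_s) ≤ ℓ^{δ₀/4}` (both eventually, `WalshStepSavAux.exists_thresholds`, from
   Mathlib's `isLittleO_log_rpow_rpow_atTop` and `tendsto_rpow_atTop`),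
   `E ≤ (1 + 2 C_s) ℓ^{2ε} N/(ℓ^{t+1} ℓ^{δ₀})` and `2ε(t+1) + 2ε = δ₀/4`, so the error is at
   most `ℓ^{δ₀/4} ℓ^{δ₀/4} N/(ℓ^{t+1} ℓ^{δ₀}) = N/(ℓ^{t+1} ℓ^{δ₀/2})`.

No number theory is used beyond the four hypotheses.

References: E. Bombieri, *The asymptotic sieve*, Rend. Accad. Naz. XL (5) 1/2 (1975/76) 243–269
[BombieriAsymptoticSieve1976]; B. Green, T. Tao, Ann. of Math. 171 (2010), Def. 1.1, (1.1), (1.4)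
[GreenTao2010].
-/

noncomputable section

open scoped BigOperators Classical
open Finset Filter Literature.NumberTheory.Sieve
open Summit.Parity.GeneralizedHardyLittlewood.Cruxes.CellParityLaw.SectionAnnihilator
open Summit.Parity.GeneralizedHardyLittlewood.Cruxes.AbsoluteUpgrade.DipMarginRateExchange (slowDegree
  four_le_slowDegree quantClip_schedule)

namespace Summit.Parity.GeneralizedHardyLittlewood.Cruxes.CellParityLawSaving.SuperPolyBand

namespace WalshStepSavAux

/-- **The budget arithmetic of the step along the schedule.** With `ℓ = log N > 1`,
`a₊/a₋ = (ℓ^ε/ℓ)/(ℓ^{-ε}/ℓ) = ℓ^{2ε}` and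
`E = N/(ℓ^{t+1} ℓ^{δ₁}) + 2 (ℓ^ε/ℓ) (C_s (log ℓ)^D) · N/(ℓ^t ℓ^{δ₂})`, one has
`2^{t+3} (a₊/a₋)^{t+1} E ≤ N/(ℓ^{t+1} ℓ^{δ₀/2})` as soon as `δ₀ ≤ δ₁, δ₂`,
`2ε(t+2) = δ₀/4`, `(log ℓ)^D ≤ ℓ^ε` and `2^{t+3} (1 + 2 C_s) ≤ ℓ^{δ₀/4}` (indeed
`E ≤ (1 + 2 C_s) ℓ^{2ε} ℓ^{-δ₀} N/ℓ^{t+1}`). -/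
theorem budget_le {t D : ℕ} {N ℓ ε δ₀ δ₁ δ₂ Cs : ℝ} (hℓ : 1 < ℓ) (hN : 0 ≤ N)
    (hCs : 0 ≤ Cs) (hε : 0 ≤ ε) (hδ₁ : δ₀ ≤ δ₁) (hδ₂ : δ₀ ≤ δ₂)
    (hεδ : 2 * ε * ((t : ℝ) + 2) = δ₀ / 4) (hlog : Real.log ℓ ^ D ≤ ℓ ^ ε)
    (hbig : 2 ^ (t + 3) * (1 + 2 * Cs) ≤ ℓ ^ (δ₀ / 4)) :
    2 ^ (t + 3) * ((ℓ ^ ε / ℓ) / (ℓ ^ (-ε) / ℓ)) ^ (t + 1) *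
        (N / (ℓ ^ (t + 1) * ℓ ^ δ₁) +
          2 * (ℓ ^ ε / ℓ) * (Cs * Real.log ℓ ^ D) * (N / (ℓ ^ t * ℓ ^ δ₂)))
      ≤ N / (ℓ ^ (t + 1) * ℓ ^ (δ₀ / 2)) := by
  have hℓ0 : 0 < ℓ := one_pos.trans hℓ
  have hℓ1 : 1 ≤ ℓ := hℓ.le
  -- the two auxiliary powers `P = ℓ^{δ₀/4}`, `Q = ℓ^{2ε}`
  obtain ⟨P, hP⟩ : ∃ P : ℝ, ℓ ^ (δ₀ / 4) = P := ⟨_, rfl⟩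
  obtain ⟨Q, hQ⟩ : ∃ Q : ℝ, ℓ ^ (2 * ε) = Q := ⟨_, rfl⟩
  have hP0 : 0 < P := hP ▸ Real.rpow_pos_of_pos hℓ0 _
  have hQ1 : 1 ≤ Q := hQ ▸ Real.one_le_rpow hℓ1 (by positivity)
  have hQ0 : 0 < Q := one_pos.trans_le hQ1
  have hQε : ℓ ^ ε * ℓ ^ ε = Q := by rw [← Real.rpow_add hℓ0, ← two_mul, hQ]
  have hQP : Q ^ (t + 2) = P := by
    rw [← hQ, ← hP, ← Real.rpow_natCast, ← Real.rpow_mul hℓ0.le]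
    congr 1
    push_cast
    linarith [hεδ]
  have hP2 : ℓ ^ (δ₀ / 2) = P ^ 2 := by
    rw [← hP, ← Real.rpow_natCast, ← Real.rpow_mul hℓ0.le]
    congr 1
    push_cast
    ring
  have hP4 : ℓ ^ δ₀ = P ^ 4 := by
    rw [← hP, ← Real.rpow_natCast, ← Real.rpow_mul hℓ0.le]
    congr 1
    push_cast
    ring
  have hδ₁' : P ^ 4 ≤ ℓ ^ δ₁ := hP4 ▸ Real.rpow_le_rpow_of_exponent_le hℓ1 hδ₁
  have hδ₂' : P ^ 4 ≤ ℓ ^ δ₂ := hP4 ▸ Real.rpow_le_rpow_of_exponent_le hℓ1 hδ₂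
  have hratio : (ℓ ^ ε / ℓ) / (ℓ ^ (-ε) / ℓ) = Q := by
    rw [div_div_div_cancel_right₀ hℓ0.ne', Real.rpow_neg hℓ0.le, div_inv_eq_mul, hQε]
  have hbig' : 2 ^ (t + 3) * (1 + 2 * Cs) ≤ P := hP ▸ hbig
  rw [hratio]
  calc 2 ^ (t + 3) * Q ^ (t + 1) *
        (N / (ℓ ^ (t + 1) * ℓ ^ δ₁) +
          2 * (ℓ ^ ε / ℓ) * (Cs * Real.log ℓ ^ D) * (N / (ℓ ^ t * ℓ ^ δ₂)))
      ≤ 2 ^ (t + 3) * Q ^ (t + 1) *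
        (N / (ℓ ^ (t + 1) * P ^ 4) +
          2 * (ℓ ^ ε / ℓ) * (Cs * ℓ ^ ε) * (N / (ℓ ^ t * P ^ 4))) := by
        gcongr
    _ = 2 ^ (t + 3) * (Q ^ (t + 1) * (1 + 2 * Cs * (ℓ ^ ε * ℓ ^ ε))) *
          (N / (ℓ ^ (t + 1) * P ^ 4)) := by
        field_simp
        ring
    _ ≤ 2 ^ (t + 3) * (Q ^ (t + 1) * ((1 + 2 * Cs) * Q)) * (N / (ℓ ^ (t + 1) * P ^ 4)) := by
        rw [hQε]
        gcongr
        nlinarith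
    _ = 2 ^ (t + 3) * (1 + 2 * Cs) * Q ^ (t + 2) * (N / (ℓ ^ (t + 1) * P ^ 4)) := by ring
    _ ≤ P * P * (N / (ℓ ^ (t + 1) * P ^ 4)) := by
        rw [hQP]
        gcongr
    _ = N / (ℓ ^ (t + 1) * P ^ 2) := by
        field_simp
    _ = N / (ℓ ^ (t + 1) * ℓ ^ (δ₀ / 2)) := by rw [hP2]

/-- **Thresholds.** For `ε, η > 0`, `D : ℕ` and `c : ℝ`: for all large `N : ℕ`,
`log N > 1`, `(log log N)^D ≤ (log N)^ε` and `c ≤ (log N)^η` (Mathlib's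
`isLittleO_log_rpow_rpow_atTop` and `tendsto_rpow_atTop`, composed with `log N → ∞`). -/
theorem exists_thresholds {ε η : ℝ} (hε : 0 < ε) (hη : 0 < η) (D : ℕ) (c : ℝ) :
    ∃ N₀ : ℕ, ∀ N : ℕ, N₀ ≤ N →
      1 < Real.log N ∧ Real.log (Real.log N) ^ D ≤ Real.log N ^ ε ∧
        c ≤ Real.log N ^ η := by
  have h1 : ∀ᶠ x : ℝ in atTop, 1 < x := eventually_gt_atTop 1
  have h2 : ∀ᶠ x : ℝ in atTop, Real.log x ^ D ≤ x ^ ε := by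
    have hlo := (isLittleO_log_rpow_rpow_atTop (D : ℝ) hε).bound one_pos
    filter_upwards [hlo, eventually_ge_atTop 1] with x hx hx1
    have hl : 0 ≤ Real.log x := Real.log_nonneg hx1
    rw [one_mul, Real.norm_eq_abs, Real.norm_eq_abs, abs_of_nonneg (Real.rpow_nonneg hl _),
      abs_of_nonneg (Real.rpow_nonneg (by linarith) _), Real.rpow_natCast] at hx
    exact hx
  have h3 : ∀ᶠ x : ℝ in atTop, c ≤ x ^ η := (tendsto_rpow_atTop hη).eventually_ge_atTop c
  have hlog : Tendsto (fun N : ℕ => Real.log (N : ℝ)) atTop atTop :=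
    Real.tendsto_log_atTop.comp tendsto_natCast_atTop_atTop
  obtain ⟨N₀, hN₀⟩ := Filter.eventually_atTop.1 (hlog.eventually (h1.and (h2.and h3)))
  exact ⟨N₀, fun N hN => hN₀ N hN⟩

end WalshStepSavAux

open WalshStepAux WalshStepSavAux SingularRatio in
/-- **`stub_walshStepSav`** (registered stub of the line `superpoly-band-same-atom`; INLINED
signature = `WalshStepSav`): the Walsh / tensor induction step along the schedule `u = U(N)` —
anatomy bounds along the schedule + singular-series bookkeeping + the section law along the
schedule for `(t+1)`-form systems (saving `δ₁`) + the law along the schedule for `t`-form systems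
(saving `δ₂`) ⟹ the law along the schedule for `(t+1)`-form systems, with saving
`min(δ₁, δ₂)/2`. Densities at `ε = min(δ₁,δ₂)/(8(t+2))`; thresholds `(log log N)^D ≤ (log N)^ε`,
`2^{t+3} (1 + 2 C_s) ≤ (log N)^{min(δ₁,δ₂)/4}`. -/
theorem stub_walshStepSav : (∀ ε : ℝ, 0 < ε → ∃ N₀ : ℕ, ∀ N : ℕ, N₀ ≤ N → (∀ m : ℕ, modelDensity N (slowDegree N) m ≤ Real.log N ^ ε / Real.log N) ∧ (∀ m : ℕ, 1 ≤ m → m < slowDegree N → Real.log N ^ (-ε) / Real.log N ≤ modelDensity N (slowDegree N) m) ∧ (∀ m : ℕ, slowDegree N ≤ m → modelDensity N (slowDegree N) m = 0)) → SingularRatioBound → ∀ t : ℕ, 1 ≤ t → (∀ L : ℕ, ∃ δ : ℝ, 0 < δ ∧ ∃ N₀ : ℕ, ∀ N : ℕ, N₀ ≤ N → ∀ Ψ : Fin (t + 1) → AffLinForm 1, IsNondegenerateSystem Ψ → affLinSize Ψ N ≤ L → ∀ K : Set (Fin 1 → ℝ), Convex ℝ K → K ⊆ realBox 1 N → ∀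 i : Fin (t + 1), ∀ j' : Fin t → ℕ, (∀ k, 1 ≤ j' k ∧ j' k ≤ slowDegree N) → ∃ δ' : ℝ, 0 ≤ δ' ∧ δ' ≤ 2 ∧ ∀ m : ℕ, 1 ≤ m → m ≤ slowDegree N → |(cell Ψ K N (slowDegree N) (i.insertNth m j') : ℝ) - (1 + (δ' - 1) * (-1 : ℝ) ^ m) * modelDensity N (slowDegree N) m * (singularProduct Ψ / singularProduct (Fin.removeNth i Ψ)) * (sectionMass Ψ K N (slowDegree N) i j' 1 : ℝ)| ≤ (N : ℝ) / (Real.log N ^ (t + 1) * Real.log N ^ δ)) → (∀ L : ℕ, ∃ δ : ℝ, 0 < δ ∧ ∃ N₀ : ℕ, ∀ N : ℕ, N₀ ≤ N → ∀ Ψ : Fin t → AffLinForm 1, IsNondegenerateSystem Ψ → affLinSize Ψ N ≤ L → ∀ K : Set (Fin 1 → ℝ), Convex ℝ K → K ⊆ realBox 1 N → ∃ θ : Finset (Fin t) → ℝ, θ ∅ = 1 ∧ (∀ S, |θ S| ≤ 2) ∧ ∀ j : Fin t → ℕ, (∀ i, 1 ≤ j i ∧ j i ≤ slowDegree N) → |(cell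 Ψ K N (slowDegree N) j : ℝ) - walsh θ j * (archFactor Ψ K * singularProduct Ψ * ∏ i, modelDensity N (slowDegree N) (j i))| ≤ (N : ℝ) / (Real.log N ^ t * Real.log N ^ δ)) → (∀ L : ℕ, ∃ δ : ℝ, 0 < δ ∧ ∃ N₀ : ℕ, ∀ N : ℕ, N₀ ≤ N → ∀ Ψ : Fin (t + 1) → AffLinForm 1, IsNondegenerateSystem Ψ → affLinSize Ψ N ≤ L → ∀ K : Set (Fin 1 → ℝ), Convex ℝ K → K ⊆ realBox 1 N → ∃ θ : Finset (Fin (t + 1)) → ℝ, θ ∅ = 1 ∧ (∀ S, |θ S| ≤ 2) ∧ ∀ j : Fin (t + 1) → ℕ, (∀ i, 1 ≤ j i ∧ j i ≤ slowDegree N) → |(cell Ψ K N (slowDegree N) j : ℝ) - walsh θ j * (archFactor Ψ K * singularProduct Ψ * ∏ i, modelDensity N (slowDegree N) (j i))| ≤ (N : ℝ) / (Real.log N ^ (t + 1) * Real.log N ^ δ)) := by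
  intro hDens hSing t _ht hSec hIH L
  obtain ⟨δ₁, hδ₁, N₃, hN₃⟩ := hSec L
  obtain ⟨δ₂, hδ₂, N₄, hN₄⟩ := hIH L
  obtain ⟨Cs, hCs, D, N₂, hN₂⟩ := hSing t L
  obtain ⟨δ₀, hδ₀⟩ : ∃ δ₀ : ℝ, δ₀ = min δ₁ δ₂ := ⟨_, rfl⟩
  have hδ₀pos : 0 < δ₀ := by rw [hδ₀]; exact lt_min hδ₁ hδ₂
  have hδ₀₁ : δ₀ ≤ δ₁ := by rw [hδ₀]; exact min_le_left _ _
  have hδ₀₂ : δ₀ ≤ δ₂ := by rw [hδ₀]; exact min_le_right _ _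
  obtain ⟨ε, hε⟩ : ∃ ε : ℝ, ε = δ₀ / (8 * ((t : ℝ) + 2)) := ⟨_, rfl⟩
  have hεpos : 0 < ε := by rw [hε]; positivity
  have hεδ : 2 * ε * ((t : ℝ) + 2) = δ₀ / 4 := by
    rw [hε]
    field_simp
    ring
  obtain ⟨N₁, hN₁⟩ := hDens ε hεpos
  obtain ⟨N₅, hN₅⟩ := exists_thresholds hεpos (by positivity : 0 < δ₀ / 4) D
    (2 ^ (t + 3) * (1 + 2 * Cs))
  refine ⟨δ₀ / 2, half_pos hδ₀pos, max (max (max N₁ N₂) (max N₃ N₄)) N₅, ?_⟩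
  intro N hN Ψ hΨ hL K hK hKN
  -- unpacking `N ≥ N₀`
  have hN' : max (max N₁ N₂) (max N₃ N₄) ≤ N := le_trans (le_max_left _ _) hN
  have hN₁N : N₁ ≤ N := le_trans (le_trans (le_max_left _ _) (le_max_left _ _)) hN'
  have hN₂N : N₂ ≤ N := le_trans (le_trans (le_max_right _ _) (le_max_left _ _)) hN'
  have hN₃N : N₃ ≤ N := le_trans (le_trans (le_max_left _ _) (le_max_right _ _)) hN'
  have hN₄N : N₄ ≤ N := le_trans (le_trans (le_max_right _ _) (le_max_right _ _)) hN'
  obtain ⟨hℓ1, hlogD, hbig⟩ := hN₅ N (le_trans (le_max_right _ _) hN)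
  have hℓ : 0 < Real.log N := one_pos.trans hℓ1
  have hu : 2 ≤ slowDegree N := le_trans (by norm_num) (four_le_slowDegree N)
  -- the four hypotheses at `N`
  obtain ⟨hdens_le, hdens_ge, hdens_top⟩ := hN₁ N hN₁N
  have hsing := hN₂ N hN₂N Ψ hΨ hL
  have hIHi : ∀ i : Fin (t + 1), ∃ θ : Finset (Fin t) → ℝ, θ ∅ = 1 ∧ (∀ S, |θ S| ≤ 2) ∧
      ∀ j' : Fin t → ℕ, (∀ k, 1 ≤ j' k ∧ j' k ≤ slowDegree N) →
        |(cell (Fin.removeNth i Ψ) (K ∩ {x | 0 < (Ψ i).realEval x}) N (slowDegree N) j' : ℝ) -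
            walsh θ j' * (archFactor (Fin.removeNth i Ψ) (K ∩ {x | 0 < (Ψ i).realEval x}) *
              singularProduct (Fin.removeNth i Ψ) *
                ∏ k, modelDensity N (slowDegree N) (j' k))|
          ≤ (N : ℝ) / (Real.log N ^ t * Real.log N ^ δ₂) := fun i =>
    hN₄ N hN₄N (Fin.removeNth i Ψ) (isNondegenerateSystem_removeNth hΨ i)
      ((affLinSize_removeNth_le Ψ i N).trans hL) _ (convex_inter_realEval_pos (Ψ i) hK)
      (Set.inter_subset_left.trans hKN)
  choose θ' hθ'0 hθ'b hθ' using hIHi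
  have hδi : ∀ (i : Fin (t + 1)) (j' : Fin t → ℕ), ∃ δ : ℝ, 0 ≤ δ ∧ δ ≤ 2 ∧
      ((∀ k, 1 ≤ j' k ∧ j' k ≤ slowDegree N) → ∀ m : ℕ, 1 ≤ m → m ≤ slowDegree N →
        |(cell Ψ K N (slowDegree N) (i.insertNth m j') : ℝ) -
            (1 + (δ - 1) * (-1 : ℝ) ^ m) * modelDensity N (slowDegree N) m *
              (singularProduct Ψ / singularProduct (Fin.removeNth i Ψ)) *
                (sectionMass Ψ K N (slowDegree N) i j' 1 : ℝ)|
          ≤ (N : ℝ) / (Real.log N ^ (t + 1) * Real.log N ^ δ₁)) := by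
    intro i j'
    by_cases hj' : ∀ k, 1 ≤ j' k ∧ j' k ≤ slowDegree N
    · obtain ⟨δ, h0, h2, h⟩ := hN₃ N hN₃N Ψ hΨ hL K hK hKN i j' hj'
      exact ⟨δ, h0, h2, fun _ => h⟩
    · exact ⟨1, zero_le_one, one_le_two, fun h => absurd h hj'⟩
  choose δ hδ0 hδ2 hδ using hδi
  -- Step 1: the coordinate estimate
  have hsec : ∀ (i : Fin (t + 1)) (j' : Fin t → ℕ), (∀ k, 1 ≤ j' k ∧ j' k ≤ slowDegree N) →
      ∀ m : ℕ, 1 ≤ m → m ≤ slowDegree N →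
        |(cell Ψ K N (slowDegree N) (i.insertNth m j') : ℝ) -
            (1 + (δ i j' - 1) * (-1 : ℝ) ^ m) *
              (∑ S, θ' i S * ∏ k ∈ S, (-1 : ℝ) ^ (j' k + 1)) *
                (archFactor Ψ K * singularProduct Ψ) *
                  (modelDensity N (slowDegree N) m *
                    ∏ k, modelDensity N (slowDegree N) (j' k))|
          ≤ (N : ℝ) / (Real.log N ^ (t + 1) * Real.log N ^ δ₁) +
              2 * (Real.log N ^ ε / Real.log N) * (Cs * Real.log (Real.log N) ^ D) *
                ((N : ℝ) / (Real.log N ^ t * Real.log N ^ δ₂)) := by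
    intro i j' hj' m hm1 hmu
    have h1 := hδ i j' hj' m hm1 hmu
    have h2 := hθ' i j' hj'
    rw [← sectionMass_one_eq_cell Ψ K N (slowDegree N) i j', archFactor_removeNth_inter] at h2
    obtain ⟨hSi, hS, hratio⟩ := hsing i
    have hRS : singularProduct Ψ / singularProduct (Fin.removeNth i Ψ) *
        singularProduct (Fin.removeNth i Ψ) = singularProduct Ψ := by
      by_cases h0 : singularProduct (Fin.removeNth i Ψ) = 0
      · rw [h0, mul_zero] at hratio
        rw [h0, mul_zero]
        exact le_antisymm hS hratio
      · exact div_mul_cancel₀ _ h0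
    have hR0 : 0 ≤ singularProduct Ψ / singularProduct (Fin.removeNth i Ψ) := div_nonneg hS hSi
    have hRB : singularProduct Ψ / singularProduct (Fin.removeNth i Ψ) ≤
        Cs * Real.log (Real.log N) ^ D := by
      by_cases h0 : singularProduct (Fin.removeNth i Ψ) = 0
      · rw [h0, div_zero]; exact mul_nonneg hCs.le (pow_nonneg (Real.log_nonneg hℓ1.le) D)
      · rw [div_le_iff₀ (lt_of_le_of_ne hSi (Ne.symm h0))]
        exact hratio
    exact ParityWalsh.abs_sub_main_le_of_section h1 h2 hRS
      (abs_parityWeight_le (hδ0 i j') (hδ2 i j') m) (modelDensity_nonneg N (slowDegree N) m)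
      (hdens_le m) hR0 hRB
  -- Step 2: the tensor law from the section laws, and the budget
  obtain ⟨θ, hθ0, hθb, hθ⟩ := ParityWalsh.exists_walshSum_of_sections (n := t) hu
    (C := fun j => (cell Ψ K N (slowDegree N) j : ℝ)) (fun j => Nat.cast_nonneg _)
    (a := modelDensity N (slowDegree N)) (am := Real.log N ^ (-ε) / Real.log N)
    (aM := Real.log N ^ ε / Real.log N) (div_pos (Real.rpow_pos_of_pos hℓ _) hℓ)
    (modelDensity_nonneg N (slowDegree N)) hdens_le hdens_ge (hdens_top (slowDegree N) le_rfl)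
    (M := archFactor Ψ K * singularProduct Ψ)
    (mul_nonneg (archFactor_nonneg Ψ K) (hsing 0).2.1) hθ'0 hθ'b (δ := δ)
    (fun i j' => ⟨hδ0 i j', hδ2 i j'⟩) hsec
  refine ⟨θ, hθ0, hθb, fun j hj => (hθ j hj).trans ?_⟩
  exact budget_le hℓ1 (Nat.cast_nonneg N) hCs.le hεpos.le hδ₀₁ hδ₀₂ hεδ hlogD hbig

end Summit.Parity.GeneralizedHardyLittlewood.Cruxes.CellParityLawSaving.SuperPolyBand

end
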